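import Literature.Analysis.FluidPDE.EnstrophySplitting
import Literature.Analysis.FluidPDE.SerrinEnstrophyGronwall
import HarnessLib

/-!
# The `L²_t H²_x` dissipation under an `L³`-small plus bounded splitting of the velocity

Analysis/FluidPDE proof file (family `ns`), companion of `EnstrophySplitting.lean`. That file
proves von Wahl's a-priori estimate in the class `C([0, T]; L³)`: for a classical solution of the
unforced Navier–Stokes system in Tao's smooth `H¹` class on a closed slab, split on `[0, s]` as
`u(t) = (u(t) - b(t)) + b(t)` with `|b(t)| ≤ M` and `‖u(t) - b(t)‖_{L³} ≤ δ`, `δ` small,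
`∫ |∇u(s)|² ≤ exp (2M²s/ν) ∫ |∇u(0)|²` (`lintegral_frobeniusNormSq_fderiv_le_mul_exp_of_split`).
There the dissipation `ν ‖Δu‖²₂` of the enstrophy balance is entirely spent on absorbing the
`L³`-small part. Here we keep half of it, under the (four times) stronger smallness condition
`8 (δK)² ≤ ν²`, and integrate in time:

* `integral_sum_inner_fderiv_add_dissipation_le_of_split` (one time slice):
  `∫ Σᵢ ⟪∂ᵢv, ∂ᵢW⟫ + (ν/2) ‖Δv‖²₂ ≤ (2M²/ν) ∫ |∇v|²` — obtained from the slice inequality of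
  `EnstrophySplitting` applied with the fictitious viscosity `ν/2` to `W' = W - (ν/2)Δv` (which
  satisfies the momentum relation with viscosity `ν/2`), plus the integration by parts
  `∫ Σᵢ ⟪∂ᵢv, ∂ᵢΔv⟫ = -‖Δv‖²₂`;
* `integral_laplacian_sq_le_of_split` (the slab): with `G(t) = ∫ |∇u(t)|²`,
  `ν ∫₀ˢ ‖Δu(t)‖²₂ dt ≤ G(0) (1 + (4M²s/ν) e^{2M²s/ν})`, from the enstrophy balance
  `G(s) - G(0) = ∫₀ˢ 2∫Σᵢ⟪∂ᵢu, ∂ᵢ∂ₜu⟫` (`IsSmoothSpaceTimeOn.enstrophy_balance`), the slice bound,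
  and the exponential bound of `EnstrophySplitting` for `G(t)` on `[0, s]`; also in the
  lower-integral form `lintegral_laplacian_sq_le_of_split`.

This is the `L²_t Ḣ²` half of Lemarié-Rieusset 2016, Thm. 11.2 / (11.9)–(11.10)
(`ν ∫ ‖Δu‖² ≤ ‖∇u(0)‖² + …`) in von Wahl's class (Prop. 12.3, 4th item). It is the input that
makes restart arguments along a solution continuous into `L³` uniform: along such a solution the
splitting holds uniformly on compact time intervals
(`ContinuousInLpOn.exists_forall_eLpNorm_indicator_le`), so both `sup_t ∫|∇u|²` and `∫∫ |Δu|²`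
are bounded in terms of the datum only.

## References

* P. G. Lemarié-Rieusset, *The Navier–Stokes Problem in the 21st Century*, CRC Press (2016),
  Thm. 11.2 with (11.9)–(11.11) (PDF pp. 338–339) and Prop. 12.3, 4th item (PDF p. 393).
* W. von Wahl, *The equations of Navier–Stokes and abstract parabolic equations*, Vieweg (1985).
-/

noncomputable section

open MeasureTheory Set Function Filter Topology InnerProductSpace
open scoped ENNReal NNReal ContDiff RealInnerProductSpace Laplacian

namespace Literature.Analysis.FluidPDE

/-! ### Small helpers -/

/-- `‖D(Δv)(x)‖² ≤ 27 ‖D³v(x)‖²` for a `C³` field on `ℝ³` (operator norm through the standard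
basis, `∂ᵢΔv = Δ∂ᵢv` and `|Δw| ≤ 3‖D²w‖`). [folklore] -/
theorem norm_fderiv_laplacian_sq_le {F : Type*} [NormedAddCommGroup F] [InnerProductSpace ℝ F]
    [FiniteDimensional ℝ F] {v : EuclideanSpace ℝ (Fin 3) → F} (hv : ContDiff ℝ 3 v)
    (x : EuclideanSpace ℝ (Fin 3)) :
    ‖fderiv ℝ (Δ v) x‖ ^ 2 ≤ 27 * ‖iteratedFDeriv ℝ 3 v x‖ ^ 2 := by
  set e := EuclideanSpace.basisFun (Fin 3) ℝ with he
  have hdir : ∀ i, ‖fderiv ℝ (Δ v) x (e i)‖ ≤ 3 * ‖iteratedFDeriv ℝ 3 v x‖ := fun i => by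
    rw [fderiv_laplacian_apply_of_contDiff_three hv x (e i)]
    exact (norm_laplacian_le_three_mul_norm_iteratedFDeriv_two
      ((hv.fderiv_right (m := 2) (by norm_num)).clm_apply contDiff_const) x).trans
      (mul_le_mul_of_nonneg_left (norm_iteratedFDeriv_fderiv_apply_basisFun_le hv 2 (by norm_num) x i)
        (by norm_num))
  calc ‖fderiv ℝ (Δ v) x‖ ^ 2 ≤ ∑ i, ‖fderiv ℝ (Δ v) x (e i)‖ ^ 2 :=
        sq_opNorm_le_sum_sq_norm_apply e _
    _ ≤ ∑ _i : Fin 3, (3 * ‖iteratedFDeriv ℝ 3 v x‖) ^ 2 :=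
        Finset.sum_le_sum fun i _ => pow_le_pow_left₀ (norm_nonneg _) (hdir i) 2
    _ = 27 * ‖iteratedFDeriv ℝ 3 v x‖ ^ 2 := by simp; ring

/-- `∫⁻ ‖a‖ₑ² < ∞` when `‖a‖ ≤ ‖b‖ + ‖c‖` pointwise with `∫⁻ ‖b‖ₑ², ∫⁻ ‖c‖ₑ² < ∞`
(`(p + q)² ≤ 2p² + 2q²`; `b` measurable). [folklore] -/
theorem lintegral_enorm_sq_lt_top_of_norm_le_add {α : Type*} [MeasurableSpace α] {μ : Measure α}
    {G₁ G₂ G₃ : Type*} [NormedAddCommGroup G₁] [NormedAddCommGroup G₂] [NormedAddCommGroup G₃]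
    {a : α → G₁} {b : α → G₂} {c : α → G₃} (h : ∀ x, ‖a x‖ ≤ ‖b x‖ + ‖c x‖)
    (hbm : AEStronglyMeasurable b μ) (hb : ∫⁻ x, ‖b x‖ₑ ^ 2 ∂μ < ⊤)
    (hc : ∫⁻ x, ‖c x‖ₑ ^ 2 ∂μ < ⊤) : ∫⁻ x, ‖a x‖ₑ ^ 2 ∂μ < ⊤ := by
  have hpt : ∀ x, ‖a x‖ₑ ^ 2 ≤ 2 * ‖b x‖ₑ ^ 2 + 2 * ‖c x‖ₑ ^ 2 := by
    intro x
    have h1 : ‖a x‖ ^ 2 ≤ 2 * ‖b x‖ ^ 2 + 2 * ‖c x‖ ^ 2 := by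
      nlinarith [h x, norm_nonneg (a x), sq_nonneg (‖b x‖ - ‖c x‖), norm_nonneg (b x),
        norm_nonneg (c x)]
    have h2 : ENNReal.ofReal (‖a x‖ ^ 2) ≤ ENNReal.ofReal (2 * ‖b x‖ ^ 2 + 2 * ‖c x‖ ^ 2) :=
      ENNReal.ofReal_le_ofReal h1
    rw [ENNReal.ofReal_add (by positivity) (by positivity), ENNReal.ofReal_mul zero_le_two,
      ENNReal.ofReal_mul zero_le_two, ENNReal.ofReal_pow (norm_nonneg _),
      ENNReal.ofReal_pow (norm_nonneg _), ENNReal.ofReal_pow (norm_nonneg _), ofReal_norm,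
      ofReal_norm, ofReal_norm, ENNReal.ofReal_ofNat] at h2
    exact h2
  calc ∫⁻ x, ‖a x‖ₑ ^ 2 ∂μ ≤ ∫⁻ x, (2 * ‖b x‖ₑ ^ 2 + 2 * ‖c x‖ₑ ^ 2) ∂μ := lintegral_mono hpt
    _ = (∫⁻ x, 2 * ‖b x‖ₑ ^ 2 ∂μ) + ∫⁻ x, 2 * ‖c x‖ₑ ^ 2 ∂μ :=
        lintegral_add_left' ((hbm.enorm.pow_const 2).const_mul 2) _
    _ = 2 * (∫⁻ x, ‖b x‖ₑ ^ 2 ∂μ) + 2 * ∫⁻ x, ‖c x‖ₑ ^ 2 ∂μ := by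
        rw [lintegral_const_mul' _ _ (by simp), lintegral_const_mul' _ _ (by simp)]
    _ < ⊤ := ENNReal.add_lt_top.2 ⟨ENNReal.mul_lt_top (by simp) hb, ENNReal.mul_lt_top (by simp) hc⟩

/-- `∫⁻ ‖c • f‖ₑ² = ofReal (c²) ∫⁻ ‖f‖ₑ²` is finite when `∫⁻ ‖f‖ₑ²` is. [folklore] -/
theorem lintegral_enorm_sq_const_smul_lt_top {α : Type*} [MeasurableSpace α] {μ : Measure α}
    {G : Type*} [NormedAddCommGroup G] [NormedSpace ℝ G] {f : α → G} (c : ℝ)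
    (hf : ∫⁻ x, ‖f x‖ₑ ^ 2 ∂μ < ⊤) : ∫⁻ x, ‖c • f x‖ₑ ^ 2 ∂μ < ⊤ := by
  have : ∀ x, ‖c • f x‖ₑ ^ 2 = ENNReal.ofReal (|c| ^ 2) * ‖f x‖ₑ ^ 2 := by
    intro x
    rw [enorm_smul, mul_pow, Real.enorm_eq_ofReal_abs, ENNReal.ofReal_pow (abs_nonneg _)]
  simp_rw [this]
  rw [lintegral_const_mul' _ _ ENNReal.ofReal_ne_top]
  exact ENNReal.mul_lt_top ENNReal.ofReal_lt_top hf

/-! ### One time slice: the enstrophy inequality with dissipation -/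

section Slice

/-- **The enstrophy inequality with dissipation, under an `L³`-small plus bounded splitting — one
time slice.** Under the hypotheses of `integral_sum_inner_fderiv_le_of_momentum_of_split`
(`W + (v·∇)v = νΔv - ∇q`, `div v = 0`, `v` bounded, `b` measurable with `|b| ≤ M`,
`‖v - b‖_{L³} ≤ δ`, the `L²` finiteness conditions) but with the stronger smallness
`8 (δK)² ≤ ν²`:
`∫ Σᵢ ⟪∂ᵢv, ∂ᵢW⟫ + (ν/2) ‖Δv‖²₂ ≤ (2M²/ν) ∫ |∇v|²`.
Proof: `W' = W - (ν/2)Δv` satisfies `W' + (v·∇)v = (ν/2)Δv - ∇q`, so the inequality of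
`EnstrophySplitting` with viscosity `ν/2` gives `∫ Σᵢ ⟪∂ᵢv, ∂ᵢW'⟫ ≤ (2M²/ν) ∫|∇v|²`, and
`∫ Σᵢ ⟪∂ᵢv, ∂ᵢW'⟫ = ∫ Σᵢ ⟪∂ᵢv, ∂ᵢW⟫ + (ν/2)‖Δv‖²₂` by `∫ Σᵢ⟪∂ᵢv, ∂ᵢΔv⟫ = -∫⟪Δv, Δv⟫`
(Lemarié-Rieusset 2016, (11.9)–(11.10): the term `-ν‖Δu‖²₂ + …`).
[cite: LemarieRieusset2016, Thm. 11.2 (11.9)–(11.10) with Prop. 12.3] -/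
theorem integral_sum_inner_fderiv_add_dissipation_le_of_split {ν : ℝ} (hν : 0 < ν)
    {v W : EuclideanSpace ℝ (Fin 3) → EuclideanSpace ℝ (Fin 3)} {q : EuclideanSpace ℝ (Fin 3) → ℝ}
    (hv : ContDiff ℝ 3 v) (hW : ContDiff ℝ 1 W) (hq : ContDiff ℝ 1 q)
    (hmom : ∀ x, W x + FluidPDE.convect v v x = ν • (Δ v) x - gradient q x)
    (hdiv : VectorCalculus.IsDivFree v) {B : ℝ} (hB : ∀ x, ‖v x‖ ≤ B)
    {b : EuclideanSpace ℝ (Fin 3) → EuclideanSpace ℝ (Fin 3)} (hbm : AEStronglyMeasurable b volume)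
    {M : ℝ} (hbM : ∀ x, ‖b x‖ ≤ M) {δ : ℝ} (hδ0 : 0 ≤ δ)
    (ha3 : eLpNorm (fun x => v x - b x) 3 volume ≤ ENNReal.ofReal δ)
    (hδ : 8 * (δ * (SNormLESNormFDerivOfEqConst (EuclideanSpace ℝ (Fin 3))
        (volume : Measure (EuclideanSpace ℝ (Fin 3))) 2 : ℝ)) ^ 2 ≤ ν ^ 2)
    (hv1 : ∫⁻ x, ‖iteratedFDeriv ℝ 1 v x‖ₑ ^ 2 < ⊤) (hv2 : ∫⁻ x, ‖iteratedFDeriv ℝ 2 v x‖ₑ ^ 2 < ⊤)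
    (hv3 : ∫⁻ x, ‖iteratedFDeriv ℝ 3 v x‖ₑ ^ 2 < ⊤)
    (hW0 : ∫⁻ x, ‖W x‖ₑ ^ 2 < ⊤) (hW1 : ∫⁻ x, ‖iteratedFDeriv ℝ 1 W x‖ₑ ^ 2 < ⊤)
    (hq0 : ∫⁻ x, ‖q x‖ₑ ^ 2 < ⊤) (hq1 : ∫⁻ x, ‖iteratedFDeriv ℝ 1 q x‖ₑ ^ 2 < ⊤) :
    (∫ x, ∑ i, ⟪fderiv ℝ v x (EuclideanSpace.basisFun (Fin 3) ℝ i),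
        fderiv ℝ W x (EuclideanSpace.basisFun (Fin 3) ℝ i)⟫) + ν / 2 * ∫ x, ‖(Δ v) x‖ ^ 2 ≤
      2 * M ^ 2 / ν * ∫ x, FluidPDE.frobeniusNormSq (fderiv ℝ v x) := by
  set e := EuclideanSpace.basisFun (Fin 3) ℝ with he
  have he1 : ∀ i, ‖e i‖ = 1 := fun i => by simp [he]
  have hν2 : 0 < ν / 2 := half_pos hν
  have hv2' : ContDiff ℝ 2 v := hv.of_le (by norm_num)
  have hv1' : ContDiff ℝ 1 v := hv.of_le (by norm_num)
  have hΔ1 : ContDiff ℝ 1 (Δ v) := contDiff_one_laplacian_of_contDiff_three hv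
  -- continuity
  have cDv : Continuous (fderiv ℝ v) := hv.continuous_fderiv (by norm_num)
  have cdiv : ∀ i, Continuous fun x => fderiv ℝ v x (e i) := fun i => cDv.clm_apply continuous_const
  have cddv : ∀ i, Continuous fun x => fderiv ℝ (fun y => fderiv ℝ v y (e i)) x (e i) := fun i =>
    ((((hv.fderiv_right (m := 2) (by norm_num)).clm_apply contDiff_const).continuous_fderiv
      (by norm_num)).clm_apply continuous_const)
  have cDW : Continuous (fderiv ℝ W) := hW.continuous_fderiv one_ne_zero
  have cdiW : ∀ i, Continuous fun x => fderiv ℝ W x (e i) := fun i => cDW.clm_apply continuous_const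
  have cΔ : Continuous (Δ v) := hΔ1.continuous
  have cDΔ : Continuous (fderiv ℝ (Δ v)) := hΔ1.continuous_fderiv one_ne_zero
  have cdΔ : ∀ i, Continuous fun x => fderiv ℝ (Δ v) x (e i) := fun i =>
    cDΔ.clm_apply continuous_const
  -- `L²` finiteness
  have hDv_eq : ∀ x, ‖fderiv ℝ v x‖ = ‖iteratedFDeriv ℝ 1 v x‖ := fun x => by
    rw [← norm_iteratedFDeriv_fderiv, norm_iteratedFDeriv_zero]
  have l2Dv : ∫⁻ x, ‖fderiv ℝ v x‖ₑ ^ 2 < ⊤ :=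
    lintegral_enorm_sq_lt_top_of_norm_le (fun x => (hDv_eq x).le) hv1
  have l2div : ∀ i, ∫⁻ x, ‖fderiv ℝ v x (e i)‖ₑ ^ 2 < ⊤ := fun i =>
    lintegral_enorm_sq_lt_top_of_norm_le (fun x => by
      simpa [he1] using (fderiv ℝ v x).le_opNorm (e i)) l2Dv
  have l2ddv : ∀ i, ∫⁻ x, ‖fderiv ℝ (fun y => fderiv ℝ v y (e i)) x (e i)‖ₑ ^ 2 < ⊤ := fun i =>
    lintegral_enorm_sq_lt_top_of_norm_le (fun x => norm_fderiv_fderiv_apply_basisFun_le hv2' x i) hv2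
  have l2diW : ∀ i, ∫⁻ x, ‖fderiv ℝ W x (e i)‖ₑ ^ 2 < ⊤ := fun i =>
    lintegral_enorm_sq_lt_top_of_norm_le (fun x => norm_fderiv_apply_basisFun_le W x i) hW1
  have n_Δ : ∀ x, ‖(Δ v) x‖ ≤ ‖(3 : ℝ) • iteratedFDeriv ℝ 2 v x‖ := fun x => by
    rw [norm_smul, Real.norm_of_nonneg (by norm_num : (0 : ℝ) ≤ 3)]
    exact norm_laplacian_le_three_mul_norm_iteratedFDeriv_two hv2' x
  have l2Δ : ∫⁻ x, ‖(Δ v) x‖ₑ ^ 2 < ⊤ :=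
    lintegral_enorm_sq_lt_top_of_norm_le n_Δ (lintegral_enorm_sq_const_smul_lt_top 3 hv2)
  have l2DΔ : ∫⁻ x, ‖fderiv ℝ (Δ v) x‖ₑ ^ 2 < ⊤ := by
    have hpt : ∀ x, ‖fderiv ℝ (Δ v) x‖ₑ ^ 2 ≤ ENNReal.ofReal 27 * ‖iteratedFDeriv ℝ 3 v x‖ₑ ^ 2 := by
      intro x
      have h := ENNReal.ofReal_le_ofReal (norm_fderiv_laplacian_sq_le hv x)
      rw [ENNReal.ofReal_mul (by norm_num), ENNReal.ofReal_pow (norm_nonneg _),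
        ENNReal.ofReal_pow (norm_nonneg _), ofReal_norm, ofReal_norm] at h
      exact h
    calc ∫⁻ x, ‖fderiv ℝ (Δ v) x‖ₑ ^ 2 ≤ ∫⁻ x, ENNReal.ofReal 27 * ‖iteratedFDeriv ℝ 3 v x‖ₑ ^ 2 :=
          lintegral_mono hpt
      _ = ENNReal.ofReal 27 * ∫⁻ x, ‖iteratedFDeriv ℝ 3 v x‖ₑ ^ 2 :=
          lintegral_const_mul' _ _ ENNReal.ofReal_ne_top
      _ < ⊤ := ENNReal.mul_lt_top ENNReal.ofReal_lt_top hv3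
  have l2dΔ : ∀ i, ∫⁻ x, ‖fderiv ℝ (Δ v) x (e i)‖ₑ ^ 2 < ⊤ := fun i =>
    lintegral_enorm_sq_lt_top_of_norm_le (fun x => by
      simpa [he1] using (fderiv ℝ (Δ v) x).le_opNorm (e i)) l2DΔ
  -- the modified time derivative `W' = W - (ν/2) Δv`
  obtain ⟨W', hW'⟩ : ∃ W' : EuclideanSpace ℝ (Fin 3) → EuclideanSpace ℝ (Fin 3),
      W' = fun x => W x - (ν / 2) • (Δ v) x := ⟨_, rfl⟩
  have hW'x : ∀ x, W' x = W x - (ν / 2) • (Δ v) x := fun x => by rw [hW']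
  have hW'c : ContDiff ℝ 1 W' := by rw [hW']; exact hW.sub (hΔ1.const_smul (ν / 2))
  have hmom' : ∀ x, W' x + FluidPDE.convect v v x = (ν / 2) • (Δ v) x - gradient q x := by
    intro x
    have h := hmom x
    have e1 : ν • (Δ v) x = (ν / 2) • (Δ v) x + (ν / 2) • (Δ v) x := by
      rw [← add_smul]; congr 1; ring
    have e2 : W' x + FluidPDE.convect v v x = (W x + FluidPDE.convect v v x) - (ν / 2) • (Δ v) x := by
      rw [hW'x]; abel
    rw [e2, h, e1]
    abel
  have hle0 : ∀ x, ‖W' x‖ ≤ ‖W x‖ + ‖(ν / 2) • (Δ v) x‖ := fun x => by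
    rw [hW'x]; exact norm_sub_le _ _
  have hWm : AEStronglyMeasurable W volume := hW.continuous.aestronglyMeasurable
  have l2c0 : ∫⁻ x, ‖(ν / 2) • (Δ v) x‖ₑ ^ 2 < ⊤ := by
    have h : ∀ x, ‖(ν / 2) • (Δ v) x‖ₑ ^ 2 = ENNReal.ofReal (|ν / 2| ^ 2) * ‖(Δ v) x‖ₑ ^ 2 := by
      intro x
      rw [enorm_smul, mul_pow, Real.enorm_eq_ofReal_abs, ENNReal.ofReal_pow (abs_nonneg _)]
    simp_rw [h]
    rw [lintegral_const_mul' _ _ ENNReal.ofReal_ne_top]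
    exact ENNReal.mul_lt_top ENNReal.ofReal_lt_top l2Δ
  have hW'0 : ∫⁻ x, ‖W' x‖ₑ ^ 2 < ⊤ :=
    lintegral_enorm_sq_lt_top_of_norm_le_add hle0 hWm hW0 l2c0
  have hdΔ : ∀ x, DifferentiableAt ℝ (Δ v) x := fun x => hΔ1.differentiable one_ne_zero x
  have hDW' : ∀ x, fderiv ℝ W' x = fderiv ℝ W x - (ν / 2) • fderiv ℝ (Δ v) x := by
    intro x
    rw [hW', fderiv_fun_sub (hW.differentiable one_ne_zero x) ((hdΔ x).fun_const_smul _),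
      fderiv_fun_const_smul (hdΔ x)]
  have hW'1 : ∫⁻ x, ‖iteratedFDeriv ℝ 1 W' x‖ₑ ^ 2 < ⊤ := by
    have hle : ∀ x, ‖iteratedFDeriv ℝ 1 W' x‖ ≤ ‖fderiv ℝ W x‖ + ‖(ν / 2) • fderiv ℝ (Δ v) x‖ := by
      intro x
      have h1 : ‖iteratedFDeriv ℝ 1 W' x‖ = ‖fderiv ℝ W' x‖ := by
        rw [← norm_iteratedFDeriv_fderiv, norm_iteratedFDeriv_zero]
      rw [h1, hDW' x]
      exact norm_sub_le _ _
    have hDW_eq : ∀ x, ‖fderiv ℝ W x‖ = ‖iteratedFDeriv ℝ 1 W x‖ := fun x => by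
      rw [← norm_iteratedFDeriv_fderiv, norm_iteratedFDeriv_zero]
    have l2DW : ∫⁻ x, ‖fderiv ℝ W x‖ₑ ^ 2 < ⊤ :=
      lintegral_enorm_sq_lt_top_of_norm_le (fun x => (hDW_eq x).le) hW1
    have l2c : ∫⁻ x, ‖(ν / 2) • fderiv ℝ (Δ v) x‖ₑ ^ 2 < ⊤ := by
      have h : ∀ x, ‖(ν / 2) • fderiv ℝ (Δ v) x‖ₑ ^ 2 =
          ENNReal.ofReal (|ν / 2| ^ 2) * ‖fderiv ℝ (Δ v) x‖ₑ ^ 2 := by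
        intro x
        rw [enorm_smul, mul_pow, Real.enorm_eq_ofReal_abs, ENNReal.ofReal_pow (abs_nonneg _)]
      simp_rw [h]
      rw [lintegral_const_mul' _ _ ENNReal.ofReal_ne_top]
      exact ENNReal.mul_lt_top ENNReal.ofReal_lt_top l2DΔ
    exact lintegral_enorm_sq_lt_top_of_norm_le_add hle cDW.aestronglyMeasurable l2DW l2c
  -- the inequality of `EnstrophySplitting` with viscosity `ν/2`
  have hδ' : 2 * (δ * (SNormLESNormFDerivOfEqConst (EuclideanSpace ℝ (Fin 3))
      (volume : Measure (EuclideanSpace ℝ (Fin 3))) 2 : ℝ)) ^ 2 ≤ (ν / 2) ^ 2 := by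
    have : (ν / 2) ^ 2 = ν ^ 2 / 4 := by ring
    rw [this]
    linarith [hδ]
  have hS' := integral_sum_inner_fderiv_le_of_momentum_of_split hν2 hv hW'c hq hmom' hdiv hB hbm hbM
    hδ0 ha3 hδ' hv1 hv2 hv3 hW'0 hW'1 hq0 hq1
  -- pointwise: `Σᵢ ⟪∂ᵢv, ∂ᵢW'⟫ = Σᵢ ⟪∂ᵢv, ∂ᵢW⟫ - (ν/2) Σᵢ ⟪∂ᵢv, ∂ᵢΔv⟫`
  have hpt : ∀ x, ∑ i, ⟪fderiv ℝ v x (e i), fderiv ℝ W' x (e i)⟫ =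
      (∑ i, ⟪fderiv ℝ v x (e i), fderiv ℝ W x (e i)⟫) -
        (ν / 2) * ∑ i, ⟪fderiv ℝ v x (e i), fderiv ℝ (Δ v) x (e i)⟫ := by
    intro x
    rw [hDW' x, Finset.mul_sum, ← Finset.sum_sub_distrib]
    refine Finset.sum_congr rfl fun i _ => ?_
    rw [sub_apply, smul_apply, inner_sub_right, inner_smul_right]
  -- integrability of the two sums
  have iA : Integrable (fun x => ∑ i, ⟪fderiv ℝ v x (e i), fderiv ℝ W x (e i)⟫) volume :=
    integrable_finsetSum _ fun i _ =>
      integrable_of_norm_le_mul_of_lintegral_sq ((cdiv i).inner (cdiW i)).aestronglyMeasurable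
        (cdiv i) (cdiW i) (l2div i) (l2diW i) fun x => norm_inner_le_norm _ _
  have iBi : ∀ i, Integrable (fun x => ⟪fderiv ℝ v x (e i), fderiv ℝ (Δ v) x (e i)⟫) volume :=
    fun i => integrable_of_norm_le_mul_of_lintegral_sq ((cdiv i).inner (cdΔ i)).aestronglyMeasurable
      (cdiv i) (cdΔ i) (l2div i) (l2dΔ i) fun x => norm_inner_le_norm _ _
  have iB : Integrable (fun x => ∑ i, ⟪fderiv ℝ v x (e i), fderiv ℝ (Δ v) x (e i)⟫) volume :=
    integrable_finsetSum _ fun i _ => iBi i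
  -- `∫ Σᵢ ⟪∂ᵢv, ∂ᵢΔv⟫ = -∫ ‖Δv‖²`
  have hIBP : ∫ x, ∑ i, ⟪fderiv ℝ v x (e i), fderiv ℝ (Δ v) x (e i)⟫ = - ∫ x, ‖(Δ v) x‖ ^ 2 := by
    have h1 : ∀ i, Integrable (fun x => ⟪fderiv ℝ (fun y => fderiv ℝ v y (e i)) x (e i), (Δ v) x⟫)
        volume := fun i =>
      integrable_of_norm_le_mul_of_lintegral_sq ((cddv i).inner cΔ).aestronglyMeasurable (cddv i) cΔ
        (l2ddv i) l2Δ fun x => norm_inner_le_norm _ _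
    have h3 : ∀ i, Integrable (fun x => ⟪fderiv ℝ v x (e i), (Δ v) x⟫) volume := fun i =>
      integrable_of_norm_le_mul_of_lintegral_sq ((cdiv i).inner cΔ).aestronglyMeasurable (cdiv i) cΔ
        (l2div i) l2Δ fun x => norm_inner_le_norm _ _
    rw [integral_sum_inner_fderiv_fderiv_eq_neg_integral_inner_laplacian hv2' hΔ1 h1 iBi h3]
    congr 1
    exact integral_congr_ae (Eventually.of_forall fun x => real_inner_self_eq_norm_sq _)
  -- assemble
  have hint : ∫ x, ∑ i, ⟪fderiv ℝ v x (e i), fderiv ℝ W' x (e i)⟫ =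
      (∫ x, ∑ i, ⟪fderiv ℝ v x (e i), fderiv ℝ W x (e i)⟫) + ν / 2 * ∫ x, ‖(Δ v) x‖ ^ 2 := by
    rw [integral_congr_ae (Eventually.of_forall hpt), integral_sub iA (iB.const_mul _),
      integral_const_mul, hIBP]
    ring
  have h2 : M ^ 2 / (ν / 2) = 2 * M ^ 2 / ν := by field_simp
  rw [hint, h2] at hS'
  exact hS'

end Slice

/-! ### The slab: the `L²_t H²_x` dissipation bound -/

section Slab

/-- **The `L²_t H²_x` dissipation under an `L³`-small plus bounded splitting.** Let `(u, p)` be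
a classical solution of the unforced Navier–Stokes system with viscosity `ν > 0` on the closed
slab `[0, T] × ℝ³` in Tao's smooth `H¹` class (`u`, `∂ₜu`, `p` with all `L²` Sobolev norms bounded
on `[0, T]`), and suppose that on `[0, s]`, `0 < s ≤ T`, the velocity splits as
`u(t) = (u(t) - b(t)) + b(t)` with `b(t)` measurable, `|b(t)| ≤ M` (`M > 0`) and
`‖u(t) - b(t)‖_{L³} ≤ δ` with `8 (δK)² ≤ ν²` (`K` the Sobolev constant of `‖w‖_{L⁶} ≤ K‖Dw‖_{L²}`).
Then `t ↦ ‖Δu(t)‖²_{L²}` is integrable on `(0, s)` and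
`ν ∫₀ˢ ‖Δu(t)‖²_{L²} dt ≤ (1 + (4M²s/ν) e^{2M²s/ν}) ∫ |∇u(0)|²`.
Proof: the enstrophy balance `G(s) - G(0) = ∫₀ˢ 2∫Σᵢ⟪∂ᵢu, ∂ᵢ∂ₜu⟫`
(`IsSmoothSpaceTimeOn.enstrophy_balance`), the slice bound
`2∫Σᵢ⟪∂ᵢu, ∂ᵢ∂ₜu⟫ ≤ -ν‖Δu‖² + (4M²/ν) G` (`integral_sum_inner_fderiv_add_dissipation_le_of_split`),
and `G(t) ≤ e^{2M²s/ν} G(0)` on `[0, s]` (`lintegral_frobeniusNormSq_fderiv_le_mul_exp_of_split`).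
This is the `L²Ḣ²` half of Lemarié-Rieusset 2016, Thm. 11.2 (11.9)–(11.10), in von Wahl's
class (Prop. 12.3). [cite: LemarieRieusset2016, Thm. 11.2 (11.9)–(11.10) with Prop. 12.3] -/
theorem integral_laplacian_sq_le_of_split {ν T : ℝ} (hν : 0 < ν) (hT : 0 < T)
    {u : ℝ → EuclideanSpace ℝ (Fin 3) → EuclideanSpace ℝ (Fin 3)}
    {p : ℝ → EuclideanSpace ℝ (Fin 3) → ℝ} (hsol : FluidPDE.IsClassicalNSSolutionOn (Icc 0 T) ν 0 u p)
    (hu : HasBoundedSobolevNormsOn (Icc 0 T) u)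
    (hut : HasBoundedSobolevNormsOn (Icc 0 T) (FluidPDE.timeDerivWithin (Icc 0 T) u))
    (hp : ∀ n : ℕ, ∃ C : ℝ≥0, ∀ t ∈ Icc 0 T, ∫⁻ x, ‖iteratedFDeriv ℝ n (p t) x‖ₑ ^ 2 ≤ C)
    {M s : ℝ} (hM0 : 0 < M) (hs : s ∈ Ioc 0 T)
    (b : ℝ → EuclideanSpace ℝ (Fin 3) → EuclideanSpace ℝ (Fin 3))
    (hbm : ∀ t ∈ Icc 0 s, AEStronglyMeasurable (b t) volume)
    (hbM : ∀ t ∈ Icc 0 s, ∀ x, ‖b t x‖ ≤ M) {δ : ℝ} (hδ0 : 0 ≤ δ)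
    (hsmall : ∀ t ∈ Icc 0 s, eLpNorm (fun x => u t x - b t x) 3 volume ≤ ENNReal.ofReal δ)
    (hδ : 8 * (δ * (SNormLESNormFDerivOfEqConst (EuclideanSpace ℝ (Fin 3))
        (volume : Measure (EuclideanSpace ℝ (Fin 3))) 2 : ℝ)) ^ 2 ≤ ν ^ 2) :
    IntegrableOn (fun t => ∫ x, ‖(Δ (u t)) x‖ ^ 2) (Ioo 0 s) ∧
      ν * ∫ t in Ioo 0 s, ∫ x, ‖(Δ (u t)) x‖ ^ 2 ≤
        (1 + 4 * M ^ 2 * s / ν * Real.exp (2 * M ^ 2 * s / ν)) *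
          ∫ x, FluidPDE.frobeniusNormSq (fderiv ℝ (u 0) x) := by
  set e := EuclideanSpace.basisFun (Fin 3) ℝ with he
  have hU : UniqueDiffOn ℝ (Icc 0 T) := uniqueDiffOn_Icc hT
  set W : ℝ → EuclideanSpace ℝ (Fin 3) → EuclideanSpace ℝ (Fin 3) :=
    FluidPDE.timeDerivWithin (Icc 0 T) u with hW
  have hWsm : FluidPDE.IsSmoothSpaceTimeOn (Icc 0 T) W := hsol.smooth_velocity.timeDerivWithin hU
  have hsT : Icc 0 s ⊆ Icc 0 T := Icc_subset_Icc_right hs.2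
  -- a pointwise bound on `u` over the slab (Sobolev), used only for integrability
  obtain ⟨B₀, hB₀⟩ := linfty_bound_of_hasBoundedSobolevNormsOn_holds
    (fun t ht => (hsol.contDiff_velocity ht).of_le (by norm_cast)) hu
  -- uniform `L²` bounds and the enstrophy balance
  obtain ⟨C₁, hC₁⟩ := hu 1
  obtain ⟨C₂, hC₂⟩ := hut 1
  obtain ⟨D₂, hD₂⟩ := hu 2
  obtain ⟨hΦint, hGcont, hGb⟩ := hsol.smooth_velocity.enstrophy_balance hT hC₁ hC₂
  set G : ℝ → ℝ := fun t => ∫ x, FluidPDE.frobeniusNormSq (fderiv ℝ (u t) x) with hG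
  set L : ℝ → ℝ := fun t => ∫ x, ‖(Δ (u t)) x‖ ^ 2 with hL
  set Φ : ℝ → ℝ := fun t => ∫ x, 2 * ∑ i, ⟪fderiv ℝ (u t) x (e i), fderiv ℝ (W t) x (e i)⟫ with hΦ
  have hG0 : ∀ t, 0 ≤ G t := fun t => integral_nonneg fun x => FluidPDE.frobeniusNormSq_nonneg _
  have hL0 : ∀ t, 0 ≤ L t := fun t => integral_nonneg fun x => sq_nonneg _
  -- `ofReal (G t) = ∫⁻ ofReal |∇u(t)|²` on `[0, T]`
  have hfrob_lt : ∀ t ∈ Icc 0 T,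
      ∫⁻ x, ENNReal.ofReal (FluidPDE.frobeniusNormSq (fderiv ℝ (u t) x)) < ⊤ := by
    intro t ht
    calc ∫⁻ x, ENNReal.ofReal (FluidPDE.frobeniusNormSq (fderiv ℝ (u t) x))
        ≤ ∫⁻ x, 3 * ‖iteratedFDeriv ℝ 1 (u t) x‖ₑ ^ 2 := lintegral_mono fun x => by
          rw [← ofReal_norm, norm_iteratedFDeriv_one, ofReal_norm]
          exact ofReal_frobeniusNormSq_le_three_mul_enorm_sq _
      _ = 3 * ∫⁻ x, ‖iteratedFDeriv ℝ 1 (u t) x‖ₑ ^ 2 := lintegral_const_mul' _ _ (by norm_num)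
      _ < ⊤ := ENNReal.mul_lt_top (by norm_num) ((hC₁ t ht).trans_lt ENNReal.coe_lt_top)
  have ifrob : ∀ t ∈ Icc 0 T, Integrable (fun x => FluidPDE.frobeniusNormSq (fderiv ℝ (u t) x)) volume :=
    fun t ht => integrable_of_continuous_of_nonneg
      (FluidPDE.continuous_frobeniusNormSq_fderiv (hsol.contDiff_velocity ht) (by simp))
      (fun x => FluidPDE.frobeniusNormSq_nonneg _) (hfrob_lt t ht)
  have hGeq : ∀ t ∈ Icc 0 T, ENNReal.ofReal (G t) =
      ∫⁻ x, ENNReal.ofReal (FluidPDE.frobeniusNormSq (fderiv ℝ (u t) x)) := fun t ht =>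
    ofReal_integral_eq_lintegral_ofReal (ifrob t ht)
      (Eventually.of_forall fun x => FluidPDE.frobeniusNormSq_nonneg _)
  /- Step 1: the exponential bound on `[0, s]` (`EnstrophySplitting`) -/
  have hs0 : 0 < s := hs.1
  set κ : ℝ := Real.exp (2 * M ^ 2 * s / ν) with hκ
  have hκ1 : 1 ≤ κ := Real.one_le_exp (by positivity)
  have hδ2 : 2 * (δ * (SNormLESNormFDerivOfEqConst (EuclideanSpace ℝ (Fin 3))
      (volume : Measure (EuclideanSpace ℝ (Fin 3))) 2 : ℝ)) ^ 2 ≤ ν ^ 2 := by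
    nlinarith [hδ, sq_nonneg (δ * (SNormLESNormFDerivOfEqConst (EuclideanSpace ℝ (Fin 3))
      (volume : Measure (EuclideanSpace ℝ (Fin 3))) 2 : ℝ))]
  have hGle : ∀ t ∈ Icc 0 s, G t ≤ κ * G 0 := by
    intro t ht
    rcases ht.1.eq_or_lt with h0 | ht0
    · rw [← h0]
      exact le_mul_of_one_le_left (hG0 0) hκ1
    have hts : t ∈ Ioc 0 T := ⟨ht0, ht.2.trans hs.2⟩
    have hlin := lintegral_frobeniusNormSq_fderiv_le_mul_exp_of_split hν hT hsol hu hut hp hM0 hts b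
      (fun r hr => hbm r ⟨hr.1, hr.2.trans ht.2⟩) (fun r hr => hbM r ⟨hr.1, hr.2.trans ht.2⟩) hδ0
      (fun r hr => hsmall r ⟨hr.1, hr.2.trans ht.2⟩) hδ2
    rw [← hGeq t (hsT ht), ← hGeq 0 ⟨le_rfl, hT.le⟩, ← ENNReal.ofReal_mul (Real.exp_nonneg _)] at hlin
    have h1 : G t ≤ Real.exp (2 * M ^ 2 * t / ν) * G 0 :=
      (ENNReal.ofReal_le_ofReal_iff (mul_nonneg (Real.exp_nonneg _) (hG0 0))).1 hlin
    refine h1.trans (mul_le_mul_of_nonneg_right (Real.exp_le_exp.2 ?_) (hG0 0))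
    exact div_le_div_of_nonneg_right (mul_le_mul_of_nonneg_left ht.2 (by positivity)) hν.le
  /- Step 2: the slice bound `Φ(t) ≤ -ν L(t) + (4M²/ν) G(t)` on `[0, s]` -/
  have hslice : ∀ t ∈ Icc 0 s, Φ t ≤ -ν * L t + 4 * M ^ 2 / ν * G t := by
    intro t hts
    have htI : t ∈ Icc 0 T := hsT hts
    obtain ⟨C₀, hC₀⟩ := hut 0
    obtain ⟨D₃, hD₃⟩ := hu 3
    obtain ⟨P₀, hP₀⟩ := hp 0
    obtain ⟨P₁, hP₁⟩ := hp 1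
    have hzero : ∀ {f : EuclideanSpace ℝ (Fin 3) → EuclideanSpace ℝ (Fin 3)} {C : ℝ≥0},
        (∫⁻ x, ‖iteratedFDeriv ℝ 0 f x‖ₑ ^ 2 ≤ C) → ∫⁻ x, ‖f x‖ₑ ^ 2 < ⊤ := by
      intro f C h
      refine lt_of_le_of_lt ((le_of_eq (lintegral_congr fun x => ?_)).trans h) ENNReal.coe_lt_top
      rw [← ofReal_norm, ← ofReal_norm, norm_iteratedFDeriv_zero]
    have hzero' : ∀ {f : EuclideanSpace ℝ (Fin 3) → ℝ} {C : ℝ≥0},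
        (∫⁻ x, ‖iteratedFDeriv ℝ 0 f x‖ₑ ^ 2 ≤ C) → ∫⁻ x, ‖f x‖ₑ ^ 2 < ⊤ := by
      intro f C h
      refine lt_of_le_of_lt ((le_of_eq (lintegral_congr fun x => ?_)).trans h) ENNReal.coe_lt_top
      rw [← ofReal_norm, ← ofReal_norm, norm_iteratedFDeriv_zero]
    have hmom : ∀ x, W t x + FluidPDE.convect (u t) (u t) x = ν • (Δ (u t)) x - gradient (p t) x := by
      intro x
      have h := hsol.momentum t htI x
      simpa [hW] using h
    have hsl := integral_sum_inner_fderiv_add_dissipation_le_of_split hν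
      ((hsol.contDiff_velocity htI).of_le (by norm_cast))
      ((hWsm.contDiff_slice htI).of_le (by norm_cast))
      ((hsol.contDiff_pressure htI).of_le (by norm_cast)) hmom (hsol.divFree t htI)
      (fun x => hB₀ t htI x) (hbm t hts) (hbM t hts) hδ0 (hsmall t hts) hδ
      ((hC₁ t htI).trans_lt ENNReal.coe_lt_top) ((hD₂ t htI).trans_lt ENNReal.coe_lt_top)
      ((hD₃ t htI).trans_lt ENNReal.coe_lt_top)
      (hzero (hC₀ t htI)) ((hC₂ t htI).trans_lt ENNReal.coe_lt_top)
      (hzero' (hP₀ t htI)) ((hP₁ t htI).trans_lt ENNReal.coe_lt_top)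
    have h2 : Φ t = 2 * ∫ x, ∑ i, ⟪fderiv ℝ (u t) x (e i), fderiv ℝ (W t) x (e i)⟫ := by
      rw [hΦ]
      exact integral_const_mul _ _
    rw [h2]
    have h4 : 4 * M ^ 2 / ν * G t = 2 * (2 * M ^ 2 / ν * G t) := by ring
    rw [h4]
    linarith [hsl]
  /- Step 3: `L` is integrable on `(0, s)` -/
  have cΔ : ContinuousOn (fun z : ℝ × EuclideanSpace ℝ (Fin 3) => (Δ (u z.1)) z.2) (Icc 0 s ×ˢ univ) :=
    (hsol.smooth_velocity.laplacian hU).continuousOn.mono (prod_mono hsT Subset.rfl)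
  set F : ℝ × EuclideanSpace ℝ (Fin 3) → ℝ := fun z => ‖(Δ (u z.1)) z.2‖ ^ 2 with hF
  have cF : ContinuousOn F (Icc 0 s ×ˢ univ) := (cΔ.norm).pow 2
  have hFeq : ∀ t x, ‖F (t, x)‖ₑ = ‖(Δ (u t)) x‖ₑ ^ 2 := fun t x => by
    rw [hF, Real.enorm_eq_ofReal (sq_nonneg _), ENNReal.ofReal_pow (norm_nonneg _), ofReal_norm]
  have hΔle : ∀ t ∈ Icc 0 T, ∫⁻ x, ‖(Δ (u t)) x‖ₑ ^ 2 ≤ ENNReal.ofReal 9 * D₂ := by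
    intro t ht
    have hv2 : ContDiff ℝ 2 (u t) := (hsol.contDiff_velocity ht).of_le (by norm_cast)
    calc ∫⁻ x, ‖(Δ (u t)) x‖ₑ ^ 2 ≤ ∫⁻ x, ENNReal.ofReal 9 * ‖iteratedFDeriv ℝ 2 (u t) x‖ₑ ^ 2 := by
          refine lintegral_mono fun x => ?_
          have h := norm_laplacian_le_three_mul_norm_iteratedFDeriv_two hv2 x
          have h' : ‖(Δ (u t)) x‖ ^ 2 ≤ 9 * ‖iteratedFDeriv ℝ 2 (u t) x‖ ^ 2 := by
            nlinarith [h, norm_nonneg ((Δ (u t)) x), norm_nonneg (iteratedFDeriv ℝ 2 (u t) x)]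
          have h'' := ENNReal.ofReal_le_ofReal h'
          rw [ENNReal.ofReal_mul (by norm_num), ENNReal.ofReal_pow (norm_nonneg _),
            ENNReal.ofReal_pow (norm_nonneg _), ofReal_norm, ofReal_norm] at h''
          exact h''
      _ = ENNReal.ofReal 9 * ∫⁻ x, ‖iteratedFDeriv ℝ 2 (u t) x‖ₑ ^ 2 :=
          lintegral_const_mul' _ _ ENNReal.ofReal_ne_top
      _ ≤ ENNReal.ofReal 9 * D₂ := by gcongr; exact hD₂ t ht
  have hin : ∀ t ∈ Ioo 0 s, ∫⁻ x, ‖F (t, x)‖ₑ ≤ ENNReal.ofReal 9 * D₂ := by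
    intro t ht
    refine le_of_eq_of_le (lintegral_congr fun x => hFeq t x) (hΔle t (hsT (Ioo_subset_Icc_self ht)))
  have hfin : ∫⁻ t in Ioo 0 s, ∫⁻ x, ‖F (t, x)‖ₑ < ⊤ :=
    calc ∫⁻ t in Ioo 0 s, ∫⁻ x, ‖F (t, x)‖ₑ
        ≤ ∫⁻ _ in Ioo 0 s, ENNReal.ofReal 9 * (D₂ : ℝ≥0∞) := setLIntegral_mono' measurableSet_Ioo hin
      _ < ⊤ := by
          rw [setLIntegral_const]
          exact ENNReal.mul_lt_top (ENNReal.mul_lt_top ENNReal.ofReal_lt_top ENNReal.coe_lt_top)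
            (by simp)
  have hFint : Integrable F (((volume : Measure ℝ).restrict (Ioo 0 s)).prod volume) :=
    FluidPDE.integrable_prod_of_continuousOn_of_lintegral cF hfin
  have hLint : IntegrableOn L (Ioo 0 s) := hFint.integral_prod_left
  /- Step 4: integrate the slice bound -/
  have hGint : IntegrableOn G (Ioo 0 s) :=
    ((hGcont.mono hsT).integrableOn_compact isCompact_Icc).mono_set Ioo_subset_Icc_self
  have hΦs : IntegrableOn Φ (Ioo 0 s) := hΦint.mono_set (Ioo_subset_Ioo_right hs.2)
  have hrhs : IntegrableOn (fun t => -ν * L t + 4 * M ^ 2 / ν * G t) (Ioo 0 s) :=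
    (hLint.const_mul _).add (hGint.const_mul _)
  have hint_le : ∫ t in Ioo 0 s, Φ t ≤ ∫ t in Ioo 0 s, (-ν * L t + 4 * M ^ 2 / ν * G t) :=
    setIntegral_mono_on hΦs hrhs measurableSet_Ioo fun t ht => hslice t (Ioo_subset_Icc_self ht)
  have hsplit : ∫ t in Ioo 0 s, (-ν * L t + 4 * M ^ 2 / ν * G t) =
      -ν * (∫ t in Ioo 0 s, L t) + 4 * M ^ 2 / ν * ∫ t in Ioo 0 s, G t := by
    rw [integral_add (hLint.const_mul _) (hGint.const_mul _), integral_const_mul, integral_const_mul]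
  have hGint_le : ∫ t in Ioo 0 s, G t ≤ κ * G 0 * s := by
    have h1 : ∫ t in Ioo 0 s, G t ≤ ∫ _ in Ioo 0 s, κ * G 0 :=
      setIntegral_mono_on hGint (integrableOn_const (by simp [Real.volume_Ioo]))
        measurableSet_Ioo fun t ht => hGle t (Ioo_subset_Icc_self ht)
    rw [setIntegral_const, measureReal_def, Real.volume_Ioo, sub_zero, ENNReal.toReal_ofReal hs.1.le,
      smul_eq_mul] at h1
    linarith
  -- the balance `G s - G 0 = ∫_{(0,s)} Φ`
  have hbal : ∫ t in Ioo 0 s, Φ t = G s - G 0 := by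
    have h := hGb s hs
    rw [intervalIntegral.integral_of_le hs.1.le, integral_Ioc_eq_integral_Ioo] at h
    simp only [hG, hΦ] at h ⊢
    linarith
  refine ⟨hLint, ?_⟩
  have hGs := hG0 s
  have hκ0 : 0 ≤ κ * G 0 * s := mul_nonneg (mul_nonneg (by positivity) (hG0 0)) hs0.le
  have hcoef : 0 ≤ 4 * M ^ 2 / ν := by positivity
  have h5 : 4 * M ^ 2 / ν * ∫ t in Ioo 0 s, G t ≤ 4 * M ^ 2 / ν * (κ * G 0 * s) :=
    mul_le_mul_of_nonneg_left hGint_le hcoef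
  have hfinal : ν * ∫ t in Ioo 0 s, L t ≤ G 0 + 4 * M ^ 2 / ν * (κ * G 0 * s) := by
    linarith [hint_le, hsplit, hbal, h5]
  calc ν * ∫ t in Ioo 0 s, L t ≤ G 0 + 4 * M ^ 2 / ν * (κ * G 0 * s) := hfinal
    _ = (1 + 4 * M ^ 2 * s / ν * κ) * G 0 := by ring

/-- **The `L²_t H²_x` dissipation under an `L³`-small plus bounded splitting, lower-integral
form**: under the hypotheses of `integral_laplacian_sq_le_of_split`,
`∫₀ˢ ∫ ‖Δu‖ₑ² ≤ ofReal (ν⁻¹ (1 + (4M²s/ν) e^{2M²s/ν})) ∫ ofReal |∇u(0)|²`. [cite: LemarieRieusset2016, Thm. 11.2 (11.9)–(11.10) with Prop. 12.3] -/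
theorem lintegral_laplacian_sq_le_of_split {ν T : ℝ} (hν : 0 < ν) (hT : 0 < T)
    {u : ℝ → EuclideanSpace ℝ (Fin 3) → EuclideanSpace ℝ (Fin 3)}
    {p : ℝ → EuclideanSpace ℝ (Fin 3) → ℝ} (hsol : FluidPDE.IsClassicalNSSolutionOn (Icc 0 T) ν 0 u p)
    (hu : HasBoundedSobolevNormsOn (Icc 0 T) u)
    (hut : HasBoundedSobolevNormsOn (Icc 0 T) (FluidPDE.timeDerivWithin (Icc 0 T) u))
    (hp : ∀ n : ℕ, ∃ C : ℝ≥0, ∀ t ∈ Icc 0 T, ∫⁻ x, ‖iteratedFDeriv ℝ n (p t) x‖ₑ ^ 2 ≤ C)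
    {M s : ℝ} (hM0 : 0 < M) (hs : s ∈ Ioc 0 T)
    (b : ℝ → EuclideanSpace ℝ (Fin 3) → EuclideanSpace ℝ (Fin 3))
    (hbm : ∀ t ∈ Icc 0 s, AEStronglyMeasurable (b t) volume)
    (hbM : ∀ t ∈ Icc 0 s, ∀ x, ‖b t x‖ ≤ M) {δ : ℝ} (hδ0 : 0 ≤ δ)
    (hsmall : ∀ t ∈ Icc 0 s, eLpNorm (fun x => u t x - b t x) 3 volume ≤ ENNReal.ofReal δ)
    (hδ : 8 * (δ * (SNormLESNormFDerivOfEqConst (EuclideanSpace ℝ (Fin 3))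
        (volume : Measure (EuclideanSpace ℝ (Fin 3))) 2 : ℝ)) ^ 2 ≤ ν ^ 2) :
    ∫⁻ t in Ioo 0 s, ∫⁻ x, ‖(Δ (u t)) x‖ₑ ^ 2 ≤
      ENNReal.ofReal (ν⁻¹ * (1 + 4 * M ^ 2 * s / ν * Real.exp (2 * M ^ 2 * s / ν))) *
        ∫⁻ x, ENNReal.ofReal (FluidPDE.frobeniusNormSq (fderiv ℝ (u 0) x)) := by
  obtain ⟨hLint, hmain⟩ := integral_laplacian_sq_le_of_split hν hT hsol hu hut hp hM0 hs b hbm hbM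
    hδ0 hsmall hδ
  -- every slice `x ↦ ‖Δu(t, x)‖²` is integrable
  obtain ⟨D₂, hD₂⟩ := hu 2
  have hsT : Icc 0 s ⊆ Icc 0 T := Icc_subset_Icc_right hs.2
  have hslice_int : ∀ t ∈ Icc 0 T, Integrable (fun x => ‖(Δ (u t)) x‖ ^ 2) volume := by
    intro t ht
    have hv2 : ContDiff ℝ 2 (u t) := (hsol.contDiff_velocity ht).of_le (by norm_cast)
    refine FluidPDE.integrable_sq_norm_of_lintegral_lt_top
      (contDiff_one_laplacian_of_contDiff_three ((hsol.contDiff_velocity ht).of_le (by norm_cast))).continuous ?_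
    have n_Δ : ∀ x, ‖(Δ (u t)) x‖ ≤ ‖(3 : ℝ) • iteratedFDeriv ℝ 2 (u t) x‖ := fun x => by
      rw [norm_smul, Real.norm_of_nonneg (by norm_num : (0 : ℝ) ≤ 3)]
      exact norm_laplacian_le_three_mul_norm_iteratedFDeriv_two hv2 x
    exact lintegral_enorm_sq_lt_top_of_norm_le n_Δ
      (lintegral_enorm_sq_const_smul_lt_top 3 ((hD₂ t ht).trans_lt ENNReal.coe_lt_top))
  -- the left-hand side as `ofReal` of the real double integral
  have hinner : ∀ t ∈ Icc 0 T, ∫⁻ x, ‖(Δ (u t)) x‖ₑ ^ 2 = ENNReal.ofReal (∫ x, ‖(Δ (u t)) x‖ ^ 2) := by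
    intro t ht
    rw [ofReal_integral_eq_lintegral_ofReal (hslice_int t ht) (Eventually.of_forall fun x => sq_nonneg _)]
    refine lintegral_congr fun x => ?_
    rw [ENNReal.ofReal_pow (norm_nonneg _), ofReal_norm]
  have hL0 : ∀ t, 0 ≤ ∫ x, ‖(Δ (u t)) x‖ ^ 2 := fun t => integral_nonneg fun x => sq_nonneg _
  have hlhs : ∫⁻ t in Ioo 0 s, ∫⁻ x, ‖(Δ (u t)) x‖ₑ ^ 2 =
      ENNReal.ofReal (∫ t in Ioo 0 s, ∫ x, ‖(Δ (u t)) x‖ ^ 2) := by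
    rw [ofReal_integral_eq_lintegral_ofReal hLint ((ae_restrict_iff' measurableSet_Ioo).2
      (Eventually.of_forall fun t _ => hL0 t))]
    exact setLIntegral_congr_fun measurableSet_Ioo fun t ht => hinner t (hsT (Ioo_subset_Icc_self ht))
  -- the right-hand side
  have hfrob_int : Integrable (fun x => FluidPDE.frobeniusNormSq (fderiv ℝ (u 0) x)) volume := by
    obtain ⟨C₁, hC₁⟩ := hu 1
    have h0 : (0 : ℝ) ∈ Icc 0 T := ⟨le_rfl, hT.le⟩
    refine integrable_of_continuous_of_nonneg
      (FluidPDE.continuous_frobeniusNormSq_fderiv (hsol.contDiff_velocity h0) (by simp))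
      (fun x => FluidPDE.frobeniusNormSq_nonneg _) ?_
    calc ∫⁻ x, ENNReal.ofReal (FluidPDE.frobeniusNormSq (fderiv ℝ (u 0) x))
        ≤ ∫⁻ x, 3 * ‖iteratedFDeriv ℝ 1 (u 0) x‖ₑ ^ 2 := lintegral_mono fun x => by
          rw [← ofReal_norm, norm_iteratedFDeriv_one, ofReal_norm]
          exact ofReal_frobeniusNormSq_le_three_mul_enorm_sq _
      _ = 3 * ∫⁻ x, ‖iteratedFDeriv ℝ 1 (u 0) x‖ₑ ^ 2 := lintegral_const_mul' _ _ (by norm_num)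
      _ < ⊤ := ENNReal.mul_lt_top (by norm_num) ((hC₁ 0 h0).trans_lt ENNReal.coe_lt_top)
  have hG0eq : ∫⁻ x, ENNReal.ofReal (FluidPDE.frobeniusNormSq (fderiv ℝ (u 0) x)) =
      ENNReal.ofReal (∫ x, FluidPDE.frobeniusNormSq (fderiv ℝ (u 0) x)) :=
    (ofReal_integral_eq_lintegral_ofReal hfrob_int
      (Eventually.of_forall fun x => FluidPDE.frobeniusNormSq_nonneg _)).symm
  have hG00 : 0 ≤ ∫ x, FluidPDE.frobeniusNormSq (fderiv ℝ (u 0) x) :=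
    integral_nonneg fun x => FluidPDE.frobeniusNormSq_nonneg _
  set A : ℝ := 1 + 4 * M ^ 2 * s / ν * Real.exp (2 * M ^ 2 * s / ν) with hA
  have hA0 : 0 ≤ A := by have := hs.1; positivity
  rw [hlhs, hG0eq, ← ENNReal.ofReal_mul (by positivity)]
  refine ENNReal.ofReal_le_ofReal ?_
  rw [mul_assoc, ← div_eq_inv_mul, le_div_iff₀' hν]
  exact hmain

end Slab

end Literature.Analysis.FluidPDE

end
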